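import Literature.Computability.QuantumComplexity.GRPredicates
import Literature.Computability.QuantumComplexity.LetterWord
import HarnessLib

/-!
# The Clifford+T word of a Grover–Rudolph level rotation read off a field of the label

Topic `Literature/Computability/QuantumComplexity`. In the Grover–Rudolph stage of Regev's quantum
sampler (Regev 2009, Lemma 3.12/3.14; Grover–Rudolph 2002) the rotation of the level's qubit `t` by the
angle of the current prefix is realised in two layers: a garbage-free classical computation writes the
`k`-bit cosine word `F` on field wires `fs` (`CleanComputePlaced.lean`), and the AJL rotation gadget
(`GadgetAssemblyGen.rotGadget_implOn_gen`) rotates `t` controlled by that field, with the sign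
predicate `SLP.grLevelB` of `GRPredicates.lean`. This file is the gadget layer, on the pattern of
`LetterWord.rotWord_good`:

* `GRWord.WiresOK kit t fs` (target and field wires are data wires of the kit, mutually apart),
  `insGR = t :: fs` (`insGR_ok`), and `gadgetLayout_useLayout'` — the kit layout lemma of
  `LetterWord.lean` with the input-length hypothesis in its general form `k + 1 + |ins| ≤ thrWd k`
  (here `|ins| = k + 1`);
* the program `prog k = grLevelB k 0` with `ok_prog`, `maxBnd_prog_lt`; `grOps`, `grFlag`, `grWord`,
  `grErr k = 9√(2·2/2^k)`; the field read off a label `fieldOf fs x` and the ideal block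
  `grBlock fs x = rotC (ã (fieldOf fs x))`;
* **`GRWord.grWord_good`** — the word is a good `ApproxStep` implementing `ctrlGate t (grBlock fs)` on
  `kit.P` up to `grErr k` (`grLevel_entry_bound` on every label).

Everything here is proved; definitions have bodies; no named fact is introduced.

## References

* L. Grover, T. Rudolph, arXiv:quant-ph/0208112 (2002), eq. (4)–(5) [GroverRudolph2002].
* O. Regev, J. ACM 56 (2009), art. 34, Lemma 3.12 (and its proof) [Regev2009].
* D. Aharonov, V. Jones, Z. Landau, Algorithmica 55 (2009), Claim 4.1, Thm. 4.3 [AharonovJonesLandau2009].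
-/

noncomputable section

namespace Literature.Computability.QuantumComplexity

open Literature.Computability.Complexity (bitsToNat bitsToNat_cons bitsToNat_lt)

open _root_.Matrix Finset Cryptography RevSim GadgetKit GaussianCells
open scoped Matrix.Norms.L2Operator

namespace GRWord

variable {N : ℕ}

/-! ### The kit layout lemma with a general input length -/

/-- **The layout of a use of the kit is a gadget layout** (as `LetterWord.gadgetLayout_useLayout`, with
the input-length hypothesis `k + 1 + |ins| ≤ thrWd k`). [folklore] -/
theorem gadgetLayout_useLayout' {kit : GadgetKit N} (hk : kit.OK) {ins : List (Fin N)} (hnd : ins.Nodup)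
    (hhad : ∀ i ∈ ins, i ∉ kit.cr :: kit.as) (hlt : ∀ i ∈ ins, (i : ℕ) < kit.rb) (hlen : kit.k + 1 + ins.length ≤ SLP.thrWd kit.k) :
    GadgetLayout kit.hN (kit.useLayout ins) kit.Wd kit.R kit.F kit.T kit.k kit.as kit.cr ins := by
  have hlenk := hk.len
  have hnd' := hk.nodup
  have hcr : kit.cr ∉ kit.as := (List.nodup_cons.1 hnd').1
  have iw_as : ∀ (j : ℕ) (hj : j < kit.as.length), (kit.useLayout ins).iw j = (kit.as[j] : ℕ) := fun j hj => by
    simp only [useLayout, dif_pos hj]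
  have iw_c : (kit.useLayout ins).iw kit.k = kit.cr := by
    simp only [useLayout, dif_neg (show ¬ kit.k < kit.as.length by omega), if_true]
  have iw_ins : ∀ (j : ℕ) (hj : j < ins.length), (kit.useLayout ins).iw (kit.k + 1 + j) = (ins[j] : ℕ) := fun j hj => by
    simp only [useLayout, dif_neg (show ¬ kit.k + 1 + j < kit.as.length by omega), if_neg (show kit.k + 1 + j ≠ kit.k by omega),
      show kit.k + 1 + j - (kit.k + 1) = j by omega, List.getD_eq_getElem?_getD, List.getElem?_eq_getElem hj, Option.getD_some]
  have iw_fin : ∀ j, j < kit.k + 1 + ins.length → ∃ x : Fin N, (kit.useLayout ins).iw j = (x : ℕ) ∧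
      ((∃ (hj : j < kit.as.length), x = kit.as[j]) ∨ (j = kit.k ∧ x = kit.cr) ∨ (∃ (j' : ℕ) (hj' : j' < ins.length), j = kit.k + 1 + j' ∧ x = ins[j'])) := by
    intro j hj
    rcases Nat.lt_or_ge j kit.k with h | h
    · exact ⟨kit.as[j]'(by omega), iw_as j (by omega), Or.inl ⟨by omega, rfl⟩⟩
    · rcases Nat.lt_or_ge j (kit.k + 1) with h1 | h1
      · have : j = kit.k := by omega
        subst this; exact ⟨kit.cr, iw_c, Or.inr (Or.inl ⟨rfl, rfl⟩)⟩
      · obtain ⟨j', rfl⟩ : ∃ j', j = kit.k + 1 + j' := ⟨j - (kit.k + 1), by omega⟩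
        exact ⟨ins[j']'(by omega), iw_ins j' (by omega), Or.inr (Or.inr ⟨j', by omega, rfl, rfl⟩)⟩
  have iw_lt_rb : ∀ j, j < kit.k + 1 + ins.length → (kit.useLayout ins).iw j < kit.rb := by
    intro j hj
    obtain ⟨x, hx, hcase⟩ := iw_fin j hj
    rw [hx]
    rcases hcase with ⟨hj', rfl⟩ | ⟨-, rfl⟩ | ⟨j', hj', -, rfl⟩
    · exact hk.had_lt _ (List.mem_cons_of_mem _ (List.getElem_mem hj'))
    · exact hk.had_lt _ (by simp)
    · exact hlt _ (List.getElem_mem hj')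
  refine
    { below := ⟨⟨hlen, iw_lt_rb, ?_, hk.fb_ge, hk.sb_ge⟩, hk.top_le,
        fun j hj => lt_of_lt_of_le (iw_lt_rb j hj) (by have := hk.fb_ge; have := hk.sb_ge; have := hk.top_le; nlinarith [Nat.zero_le (kit.R * kit.Wd), Nat.zero_le (kit.T * SLP.scrSize kit.Wd)])⟩
      kIn := rfl
      len := hlenk
      iw_as := iw_as
      iw_c := iw_c
      iw_ins := iw_ins
      nodup := (List.nodup_cons.1 hnd').2
      c_notin := hcr
      ins_off := fun i hi => ⟨fun h => hhad i hi (List.mem_cons_of_mem _ h), fun h => hhad i hi (h ▸ List.mem_cons_self ..)⟩ }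
  intro j j' hj hj' hjj
  change j < kit.k + 1 + ins.length at hj
  change j' < kit.k + 1 + ins.length at hj'
  obtain ⟨x, hx, hc⟩ := iw_fin j hj
  obtain ⟨x', hx', hc'⟩ := iw_fin j' hj'
  have hxx : x = x' := Fin.ext (by rw [← hx, ← hx', hjj])
  subst hxx
  have has_nd : kit.as.Nodup := (List.nodup_cons.1 hnd').2
  rcases hc with ⟨h1, e1⟩ | ⟨rfl, e1⟩ | ⟨i1, hi1, rfl, e1⟩ <;> rcases hc' with ⟨h2, e2⟩ | ⟨rfl, e2⟩ | ⟨i2, hi2, rfl, e2⟩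
  · exact (List.Nodup.getElem_inj_iff has_nd).1 (e1.symm.trans e2)
  · exact absurd (e2 ▸ e1 ▸ List.getElem_mem h1) hcr
  · exact absurd (List.mem_cons_of_mem _ (e1 ▸ List.getElem_mem h1)) (hhad _ (e2 ▸ List.getElem_mem hi2))
  · exact absurd (e1 ▸ e2 ▸ List.getElem_mem h2) hcr
  · rfl
  · exact absurd (e1 ▸ List.mem_cons_self ..) (hhad _ (e2 ▸ List.getElem_mem hi2))
  · exact absurd (List.mem_cons_of_mem _ (e2 ▸ List.getElem_mem h2)) (hhad _ (e1 ▸ List.getElem_mem hi1))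
  · exact absurd (e2 ▸ List.mem_cons_self ..) (hhad _ (e1 ▸ List.getElem_mem hi1))
  · have := (List.Nodup.getElem_inj_iff hnd).1 (e1.symm.trans e2); omega

/-! ### The program -/

/-- **The level program**: `grLevelB k 0` (the field starts right after the target bit). [cite: GroverRudolph2002, eq. (5)] -/
def prog (k : ℕ) : SLP.BExpr := SLP.grLevelB k 0

/-- Side conditions of the level program (`k ≥ 1`; `k + 1 + (k + 1)` input bits). [folklore] -/
theorem ok_prog {k : ℕ} (hk1 : 1 ≤ k) : (prog k).OK (SLP.thrWd k) (k + 1 + (k + 1)) := by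
  have hW : 1 ≤ SLP.thrWd k := by unfold SLP.thrWd; omega
  obtain ⟨o0, -, -, -, -, -, -⟩ := SLP.thrB_ok k (kIn := k + 1 + (k + 1)) (by omega)
  have hb : (SLP.bitB k).OK (SLP.thrWd k) (k + 1 + (k + 1)) := SLP.bitB_ok (by omega) hW
  have hb1 : (SLP.bitB (k + 1)).OK (SLP.thrWd k) (k + 1 + (k + 1)) := SLP.bitB_ok (by omega) hW
  have hb2 : (SLP.bitB (k + 2)).OK (SLP.thrWd k) (k + 1 + (k + 1)) := SLP.bitB_ok (by omega) hW
  have ht : (SLP.trueB k).OK (SLP.thrWd k) (k + 1 + (k + 1)) := ⟨hb, hb⟩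
  have ht2 : (SLP.trueB (k + 2)).OK (SLP.thrWd k) (k + 1 + (k + 1)) := ⟨hb2, hb2⟩
  have hl : (SLP.ltFieldB k 0).OK (SLP.thrWd k) (k + 1 + (k + 1)) := SLP.ltFieldB_ok (by omega) (by unfold SLP.thrWd; omega)
  have hs : (SLP.sOffB k 0).OK (SLP.thrWd k) (k + 1 + (k + 1)) := SLP.sOffB_ok (by omega) (by unfold SLP.thrWd; omega) hk1
  unfold prog SLP.grLevelB SLP.rotSignB
  exact SLP.ok_iteB ht2 (SLP.ok_iteB hb (SLP.ok_iteB hb1 hs hs) hl) (SLP.ok_iteB hb o0 ht)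

/-- Widths of the level program. [folklore] -/
theorem maxBnd_prog_lt (k : ℕ) : (prog k).maxBnd < 2 ^ SLP.thrWd k := by
  obtain ⟨h0, -, -, -, -, -, -⟩ := SLP.thrB_maxBnd_lt k
  have h2' : (2 : ℕ) < 2 ^ SLP.thrWd k :=
    calc (2 : ℕ) < 2 ^ 2 := by norm_num
      _ ≤ 2 ^ SLP.thrWd k := Nat.pow_le_pow_right (by norm_num) (by unfold SLP.thrWd; omega)
  have hb : ∀ j, (SLP.bitB j).maxBnd < 2 ^ SLP.thrWd k := fun j => by rw [SLP.bitB_maxBnd]; exact h2'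
  have ht : ∀ j, (SLP.trueB j).maxBnd < 2 ^ SLP.thrWd k := fun j => by
    simp only [SLP.trueB, SLP.BExpr.maxBnd, max_lt_iff]; exact ⟨hb j, hb j⟩
  have hl : (SLP.ltFieldB k 0).maxBnd < 2 ^ SLP.thrWd k := by
    rw [SLP.ltFieldB_maxBnd]; exact Nat.pow_lt_pow_right (by norm_num) (by unfold SLP.thrWd; omega)
  have hs : (SLP.sOffB k 0).maxBnd < 2 ^ SLP.thrWd k :=
    (SLP.sOffB_maxBnd_lt k 0).trans_le (Nat.pow_le_pow_right (by norm_num) (by unfold SLP.thrWd; omega))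
  have hns : (SLP.BExpr.not (SLP.sOffB k 0)).maxBnd < 2 ^ SLP.thrWd k := hs
  have hnl : (SLP.BExpr.not (SLP.ltFieldB k 0)).maxBnd < 2 ^ SLP.thrWd k := hl
  unfold prog SLP.grLevelB SLP.rotSignB
  exact SLP.maxBnd_iteB_lt (ht _) (SLP.maxBnd_iteB_lt (hb _) (SLP.maxBnd_iteB_lt (hb _) hs hns) hnl) (SLP.maxBnd_iteB_lt (hb _) h0 (ht _))

/-! ### Wires and the word -/

/-- **Well-placedness of the target and field wires** relative to a kit. [folklore] -/
structure WiresOK (kit : GadgetKit N) (t : Fin N) (fs : Fin kit.k ↪ Fin N) : Prop where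
  /-- data wires -/
  t_lt : (t : ℕ) < kit.rb
  fs_lt : ∀ b, (fs b : ℕ) < kit.rb
  /-- not Hadamard wires -/
  t_had : t ∉ kit.cr :: kit.as
  fs_had : ∀ b, fs b ∉ kit.cr :: kit.as
  /-- nor helpers -/
  t_hs : t ∉ kit.hs
  fs_hs : ∀ b, fs b ∉ kit.hs
  /-- the target is not a field wire -/
  t_fs : t ∉ Set.range fs

section Word

variable {kit : GadgetKit N} (hk : kit.OK) {t : Fin N} {fs : Fin kit.k ↪ Fin N} (hW : WiresOK kit t fs)

/-- The further inputs: the target, then the field wires. [folklore] -/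
def insGR (t : Fin N) (fs : Fin kit.k ↪ Fin N) : List (Fin N) := t :: List.ofFn fs

include hW in
/-- The inputs are admissible. [folklore] -/
theorem insGR_ok : (insGR t fs).Nodup ∧ (∀ i ∈ insGR t fs, i ∉ kit.cr :: kit.as) ∧ (∀ i ∈ insGR t fs, (i : ℕ) < kit.rb) ∧
    kit.k + 1 + (insGR t fs).length ≤ SLP.thrWd kit.k ∧ ∀ i ∈ insGR t fs, i ∉ kit.hs := by
  have ht := hW.t_fs
  rw [Set.mem_range, not_exists] at ht
  refine ⟨?_, ?_, ?_, ?_, ?_⟩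
  · rw [insGR, List.nodup_cons, List.mem_ofFn]
    exact ⟨fun ⟨b, hb⟩ => ht b hb, List.nodup_ofFn.2 fs.injective⟩
  · intro i hi; rw [insGR, List.mem_cons, List.mem_ofFn] at hi
    rcases hi with rfl | ⟨b, rfl⟩
    exacts [hW.t_had, hW.fs_had b]
  · intro i hi; rw [insGR, List.mem_cons, List.mem_ofFn] at hi
    rcases hi with rfl | ⟨b, rfl⟩
    exacts [hW.t_lt, hW.fs_lt b]
  · rw [insGR, List.length_cons, List.length_ofFn]; unfold SLP.thrWd; omega
  · intro i hi; rw [insGR, List.mem_cons, List.mem_ofFn] at hi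
    rcases hi with rfl | ⟨b, rfl⟩
    exacts [hW.t_hs, hW.fs_hs b]

/-- The flag program. [folklore] -/
def grOps (kit : GadgetKit N) (t : Fin N) (fs : Fin kit.k ↪ Fin N) : List (ClOp (Fin N)) :=
  gadgetOps kit.hN (kit.useLayout (insGR t fs)) (prog kit.k) (Wd := kit.Wd)

/-- Its flag wire. [folklore] -/
def grFlag (kit : GadgetKit N) (t : Fin N) (fs : Fin kit.k ↪ Fin N) : Fin N :=
  gadgetFlag kit.hN (kit.useLayout (insGR t fs)) (prog kit.k) (Wd := kit.Wd)

/-- **The bounds hypothesis**: the kit dominates the level program. [folklore] -/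
structure ProgOK (kit : GadgetKit N) : Prop where
  /-- registers -/
  R_ge : ((prog kit.k).compile kit.Wd 0 0).2.2.1 ≤ kit.R
  /-- flags -/
  F_ge : ((prog kit.k).compile kit.Wd 0 0).2.2.2 ≤ kit.F
  /-- scratch -/
  T_ge : ((prog kit.k).compile kit.Wd 0 0).1.length ≤ kit.T
  /-- at least one averaging bit -/
  one_le : 1 ≤ kit.k

variable (hP : ProgOK kit)

include hk hW hP in
/-- The flag program is well formed. [folklore] -/
theorem grOps_wf : ∀ op ∈ grOps kit t fs, op.WF := by
  obtain ⟨hnd, hhad, hlt, hlen, -⟩ := insGR_ok hW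
  have hok : (prog kit.k).OK kit.Wd (kit.k + 1 + (insGR t fs).length) := by
    rw [insGR, List.length_cons, List.length_ofFn]; exact ok_prog hP.one_le
  exact gadgetOps_wf (gadgetLayout_useLayout' hk hnd hhad hlt hlen) _ hok hP.R_ge hP.F_ge hP.T_ge

/-- **The word of the level rotation.** [cite: GroverRudolph2002, eq. (5)] [cite: AharonovJonesLandau2009, Claim 4.1] -/
def grWord : QCircuit cliffordT N :=
  oaaWordCircuit
    (sandwichCircuit (kit.cr :: kit.as) kit.cr t (fun h => hW.t_had (h ▸ List.mem_cons_self ..)) (grOps kit t fs) (grOps_wf hk hW hP) [] [grFlag kit t fs])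
    (reflectCircuit kit.cr (kit.as ++ kit.region) kit.hs hk.hs_ne (hwfR hk))

/-- The level gadget error. [folklore] -/
def grErr (k : ℕ) : ℝ := 9 * Real.sqrt (2 * (2 / 2 ^ k))

/-- **The field read off a label.** [folklore] -/
def fieldOf {k : ℕ} (fs : Fin k ↪ Fin N) (x : QReg N) : ℕ := bitsToNat (List.ofFn (x ∘ fs))

/-- The field is a `k`-bit number. [folklore] -/
theorem fieldOf_lt {k : ℕ} (fs : Fin k ↪ Fin N) (x : QReg N) : fieldOf fs x < 2 ^ k := by
  have := bitsToNat_lt (List.ofFn (x ∘ fs)); rwa [List.length_ofFn] at this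

/-- The field does not read a wire off the field wires. [folklore] -/
theorem fieldOf_update {k : ℕ} (fs : Fin k ↪ Fin N) {t : Fin N} (ht : t ∉ Set.range fs) (x : QReg N) (b : Bool) :
    fieldOf fs (Function.update x t b) = fieldOf fs x := by
  unfold fieldOf
  congr 1
  refine List.ofFn_inj.2 (funext fun i => ?_)
  exact Function.update_of_ne (fun h : fs i = t => ht ⟨i, h⟩) _ _

/-- **The ideal block**: the rotation with the encoded cosine of the field. [cite: GroverRudolph2002, eq. (4)] -/
def grBlock {k : ℕ} (fs : Fin k ↪ Fin N) (x : QReg N) : Matrix (QReg 1) (QReg 1) ℂ := rotC (SLP.aTil k (fieldOf fs x))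

/-- The ideal block is unitary. [folklore] -/
theorem grBlock_mem_unitaryGroup {k : ℕ} (fs : Fin k ↪ Fin N) (x : QReg N) : grBlock fs x ∈ Matrix.unitaryGroup (QReg 1) ℂ :=
  SLP.rotC_mem_unitaryGroup' (SLP.abs_aTil_le (fieldOf_lt fs x).le)

include hk hW hP in
/-- **The level word is a good step** implementing `ctrlGate t (grBlock fs)` on `kit.P`.
[cite: GroverRudolph2002, eq. (5)] [cite: AharonovJonesLandau2009, Claim 4.1 and Thm. 4.3] -/
theorem grWord_good : (⟨(grWord hk hW hP).toMatrix 0, ctrlGate t (grBlock fs), grErr kit.k⟩ : ApproxStep N).Good kit.P := by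
  obtain ⟨hnd, hhad, hlt, hlen, hhs⟩ := insGR_ok hW
  have G := gadgetLayout_useLayout' hk hnd hhad hlt hlen
  have hok : (prog kit.k).OK kit.Wd (kit.k + 1 + (insGR t fs).length) := by
    rw [insGR, List.length_cons, List.length_ofFn]; exact ok_prog hP.one_le
  have hR := hP.R_ge; have hF := hP.F_ge; have hT := hP.T_ge
  have hmax := maxBnd_prog_lt kit.k
  set U : QReg N → Matrix (QReg 1) (QReg 1) ℂ := grBlock fs with hU
  have hUu : ∀ x, U x ∈ Matrix.unitaryGroup (QReg 1) ℂ := fun x => grBlock_mem_unitaryGroup fs x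
  have hUt : ∀ x b, U (Function.update x t b) = U x := fun x b => by
    simp only [hU, grBlock, fieldOf_update fs hW.t_fs]
  have htr : t ∉ kit.region := not_mem_region_of_lt hk hW.t_lt
  -- helpers avoid the sandwich
  have hsw : ∀ h ∈ kit.hs, h ∉ sandwichWires (kit.cr :: kit.as) kit.cr t (grOps kit t fs) [] [grFlag kit t fs] := by
    intro h hh hmem
    simp only [sandwichWires, List.append_nil, List.mem_append, List.mem_flatMap] at hmem
    rcases hmem with ((hm | hm) | ⟨op, hop, hx⟩) | hm
    · exact hk.hs_had h hh hm
    · simp only [List.mem_cons, List.not_mem_nil, or_false] at hm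
      rcases hm with hm | hm
      · exact hk.hs_had h hh (by rw [hm]; exact List.mem_cons_self ..)
      · exact hW.t_hs (by rw [← hm]; exact hh)
    · rcases mem_of_mem_wiresOf_gadgetOps G _ hok hR hF hT hop hx with hr | hr | hr | hr
      · exact not_mem_region_of_lt hk (hk.hs_low h hh) hr
      · exact hk.hs_had h hh (List.mem_cons_of_mem _ hr)
      · exact hk.hs_had h hh (by rw [hr]; exact List.mem_cons_self ..)
      · exact hhs _ hr hh
    · rw [List.mem_singleton] at hm
      exact not_mem_region_of_lt hk (hk.hs_low _ hh) (by
        rw [hm]; exact flagW_mem_layoutRegion kit.hN _ (by have := (prog kit.k).compile_bounds kit.Wd 0 0; omega))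
  -- the implementation bound
  have himpl := rotGadget_implOn_gen (c := kit.cr) (t := t) (Fz := grFlag kit t fs) (as := kit.as) (region := kit.region)
    (hs := kit.hs) (grOps kit t fs) (grOps_wf hk hW hP) hk.nodup hW.t_had (fun h => hW.t_had (h ▸ List.mem_cons_self ..))
    htr hk.hs_len hk.hs_ne hk.hs_nodup (hk.hs_had _ · (by simp)) (hls hk) (hlsnd hk) (hwfR hk) hsw
    (fun bb x n => (prog kit.k).eval (2 ^ kit.k * hiNum bb x (insGR t fs) + n))
    (fun x hx bb n hn => clEval_gadgetOps_flag G _ hok hR hF hmax hT (fun a ha => hx a (by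
      rw [layoutRegion_useLayout] at ha; simp only [List.cons_append, List.mem_cons, List.mem_append]; exact Or.inr (Or.inr ha))) bb
      (by rw [hk.len] at hn; exact hn))
    U hUu hUt (show (0 : ℝ) ≤ 2 / 2 ^ kit.k by positivity) (fun bb x => by
      rw [hk.len]
      set rest : ℕ := bitsToNat ((List.ofFn fs).map x) with hrest
      have hrest' : rest = fieldOf fs x := by rw [hrest, fieldOf, List.map_ofFn]
      have hfv : SLP.fieldVal kit.k 0 rest = fieldOf fs x := by
        rw [SLP.fieldVal, pow_zero, Nat.div_one, hrest', Nat.mod_eq_of_lt (fieldOf_lt fs x)]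
      have key := SLP.grLevel_entry_bound hP.one_le 0 rest bb (x t)
      have e1 : ∀ n, (prog kit.k).eval (2 ^ kit.k * hiNum bb x (insGR t fs) + n) =
          (SLP.grLevelB kit.k 0).eval (2 ^ kit.k * SLP.hiOf bb (x t) rest + n) := by
        intro n; rw [prog, insGR, hiNum_cons]
      simp only [e1]
      rw [hfv] at key
      exact key)
  have ht2 : t ∉ kit.cr :: kit.as ++ kit.region := by
    rw [List.cons_append, List.mem_cons, List.mem_append, not_or, not_or]
    have h := hW.t_had; rw [List.mem_cons, not_or] at h
    exact ⟨h.1, h.2, htr⟩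
  exact
    { implOn := himpl
      act_contr := isContraction_of_mem_unitaryGroup (QCircuit.toMatrix_mem_unitaryGroup_holds cliffordT_isUnitary_holds 0 _)
      ideal_contr := isContraction_ctrlGate t hUu hUt
      ideal_pres := (preservesSupp_ctrlGate ht2 U).inter (preservesSupp_ctrlGate hW.t_hs U)
      err_nonneg := by show (0 : ℝ) ≤ grErr kit.k; unfold grErr; positivity }

end Word

end GRWord

end Literature.Computability.QuantumComplexity

end
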